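import Summits.BirchSwinnertonDyer.BirchSwinnertonDyer.Theorems.BiquadraticEisensteinDescentHeegnerTwistCouplingInSupplyQuarticPlusDescent
import HarnessLib

set_option linter.dupNamespace false -- `Summit.BirchSwinnertonDyer.BirchSwinnertonDyer.Theorems.…` (summit = sub)
set_option autoImplicit false

/-!
# Crux `HeegnerTwistCouplingInSupply` (stmt-BirchSwinnertonDyer-21381) — the quartic `j = 1728` corner, habitat H⁺, IIa:
# local kills for the dual side `S(0, −4r²pq²)` at `2`, at the partner `r`, and at `q`

Route `BiquadraticEisensteinDescent` (cell `pub/bsd-wall`, width seat `bsd-wall-cm-bed-w4` g13; `--supports` 21381, helper). For the twist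
`E = W_p⁺^{(−rq)} : y² = x³ + r²pq²·x` (`p ≡ 15 (mod 16)`, `q ≡ 3 (mod 8)` with `(q/p) = +1`, partner `r ≡ 5 (mod 8)` with `(r/p) = −1`) the
descent on the divisors of `b′ = −4r²pq²` has thirty classes to kill (sibling `…QuarticPlusDescentDual`): sixteen die at `p` (one-liners
there), and this file supplies the other fourteen: `two_adic_kills_plus_dual` (classes `q, 2q, −pq, −2pq`; no solutions modulo `16`),
`partner_kills_plus` (classes `rp, rpq, 2rp, 2rpq, −r, −rq, −2r, −2rq`: both coefficients divisible by `r`, and each reduced form rearranges to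
`X² = p·Y²`, impossible as `(p/r) = (r/p) = −1`), `q_kills_plus` (classes `2, −2p`: `2`, `−2p`, `−2r²p`, `2r²` are non-residues mod `q`, by
`(2/q) = (−1/q) = −1` and reciprocity `(p/q) = −(q/p) = −1`).

HONEST FRAMING: tools for a typed sub-corner on one CM family; the crux (residual C⁺) is untouched; BSD is not proved by any of this.
THEOREMS ONLY. Supports stmt-BirchSwinnertonDyer-21381.
-/

noncomputable section

open scoped Classical

namespace Summit.BirchSwinnertonDyer.BirchSwinnertonDyer.Theorems.BiquadraticEisensteinDescentHeegnerTwistCouplingInSupplyQuarticPlusDualKills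

open Literature.NumberTheory.EllipticCurves Literature.NumberTheory.EllipticCurves.XCubeAddPX
  Summit.BirchSwinnertonDyer.BirchSwinnertonDyer.Theorems.BiquadraticEisensteinDescentHeegnerTwistCouplingInSupplyQuarticTwistLocal
  Summit.BirchSwinnertonDyer.BirchSwinnertonDyer.Theorems.BiquadraticEisensteinDescentHeegnerTwistCouplingInSupplyQuarticPlusDescent

variable {p q r : ℕ} [hp : Fact p.Prime] [hq : Fact q.Prime] [hr : Fact r.Prime]

/-! ## §1 The four `2`-adic kills (modulo `16`) -/

omit hp hq hr in
/-- **`2`-adic kills of the dual side**: classes `q`, `2q`, `−pq`, `−2pq` of `S(0, −4r²pq²)` (`p ≡ 15 (mod 16)`, `q ≡ 3 (mod 8)`, `r ≡ 5 (mod 8)`).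
[cite: SilvermanAEC2009, proof of Prop. X.6.2(b)] -/
theorem two_adic_kills_plus_dual (hp16 : p % 16 = 15) (hq8 : q % 8 = 3) (hr8 : r % 8 = 5) :
    ¬ ((twoIsogenyQuartic 0 (q : ℤ) (-(4 * r ^ 2 * p * q : ℤ))).map (Int.castRingHom ℚ_[2])).IsSoluble ∧
    ¬ ((twoIsogenyQuartic 0 (2 * (q : ℤ)) (-(2 * r ^ 2 * p * q : ℤ))).map (Int.castRingHom ℚ_[2])).IsSoluble ∧
    ¬ ((twoIsogenyQuartic 0 (-((p : ℤ) * q)) (4 * r ^ 2 * q)).map (Int.castRingHom ℚ_[2])).IsSoluble ∧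
    ¬ ((twoIsogenyQuartic 0 (-(2 * ((p : ℤ) * q))) (2 * r ^ 2 * q)).map (Int.castRingHom ℚ_[2])).IsSoluble := by
  have hp' : (p : ZMod 16) = 15 := by simpa using natCast_zmod16_of_mod hp16 (by norm_num)
  have hq' : (q : ZMod 16) = 3 ∨ (q : ZMod 16) = 11 := by
    rcases (show q % 16 = 3 ∨ q % 16 = 11 by omega) with h | h
    · exact Or.inl (by simpa using natCast_zmod16_of_mod h (by norm_num))
    · exact Or.inr (by simpa using natCast_zmod16_of_mod h (by norm_num))
  have hr' : (r : ZMod 16) = 5 ∨ (r : ZMod 16) = 13 := by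
    rcases (show r % 16 = 5 ∨ r % 16 = 13 by omega) with h | h
    · exact Or.inl (by simpa using natCast_zmod16_of_mod h (by norm_num))
    · exact Or.inr (by simpa using natCast_zmod16_of_mod h (by norm_num))
  refine ⟨not_isSoluble_two_of_zmod16 ?_, not_isSoluble_two_of_zmod16 ?_, not_isSoluble_two_of_zmod16 ?_,
    not_isSoluble_two_of_zmod16 ?_⟩ <;>
  · push_cast
    rw [hp']
    rcases hq' with hq' | hq' <;> rcases hr' with hr' | hr' <;> rw [hq', hr'] <;> decide

/-! ## §2 The eight kills at the partner `r` -/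

omit hp hq in
/-- **The eight reduced forms at `r` are anisotropic** when `p` is a non-residue mod `r` (`r ∤ 2q`): each of `p·x⁴ − 4q²y⁴`,
`pq·x⁴ − 4q·y⁴`, `2p·x⁴ − 2q²y⁴`, `2pq·x⁴ − 2q·y⁴`, `−x⁴ + 4pq²y⁴`, `−q·x⁴ + 4pq·y⁴`, `−2x⁴ + 2pq²y⁴`, `−2q·x⁴ + 2pq·y⁴` rearranges to
`X² = p·Y²`. [folklore] -/
theorem anisotropic_plus (hnp : ¬ IsSquare ((p : ℤ) : ZMod r)) (hq0 : ((q : ℤ) : ZMod r) ≠ 0) (h20 : ((2 : ℤ) : ZMod r) ≠ 0) :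
    (∀ x y : ZMod r, ((p : ℤ) : ZMod r) * x ^ 4 + ((-(4 * q ^ 2) : ℤ) : ZMod r) * y ^ 4 = 0 → x = 0 ∧ y = 0) ∧
    (∀ x y : ZMod r, (((p : ℤ) * q : ℤ) : ZMod r) * x ^ 4 + ((-(4 * q) : ℤ) : ZMod r) * y ^ 4 = 0 → x = 0 ∧ y = 0) ∧
    (∀ x y : ZMod r, ((2 * p : ℤ) : ZMod r) * x ^ 4 + ((-(2 * q ^ 2) : ℤ) : ZMod r) * y ^ 4 = 0 → x = 0 ∧ y = 0) ∧
    (∀ x y : ZMod r, ((2 * ((p : ℤ) * q) : ℤ) : ZMod r) * x ^ 4 + ((-(2 * q) : ℤ) : ZMod r) * y ^ 4 = 0 → x = 0 ∧ y = 0) ∧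
    (∀ x y : ZMod r, ((-1 : ℤ) : ZMod r) * x ^ 4 + ((4 * p * q ^ 2 : ℤ) : ZMod r) * y ^ 4 = 0 → x = 0 ∧ y = 0) ∧
    (∀ x y : ZMod r, ((-(q : ℤ) : ℤ) : ZMod r) * x ^ 4 + ((4 * p * q : ℤ) : ZMod r) * y ^ 4 = 0 → x = 0 ∧ y = 0) ∧
    (∀ x y : ZMod r, ((-2 : ℤ) : ZMod r) * x ^ 4 + ((2 * p * q ^ 2 : ℤ) : ZMod r) * y ^ 4 = 0 → x = 0 ∧ y = 0) ∧
    (∀ x y : ZMod r, ((-(2 * q) : ℤ) : ZMod r) * x ^ 4 + ((2 * p * q : ℤ) : ZMod r) * y ^ 4 = 0 → x = 0 ∧ y = 0) := by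
  have key : ∀ X Y : ZMod r, X ^ 2 = (p : ZMod r) * Y ^ 2 → X = 0 ∧ Y = 0 := fun X Y h =>
    eq_zero_of_sq_eq_mul_sq (p := p) (r := r) hnp (X := X) (Y := Y) (by push_cast; exact h)
  have hq0' : (q : ZMod r) ≠ 0 := by simpa using hq0
  have h20' : (2 : ZMod r) ≠ 0 := by simpa using h20
  have hx : ∀ x : ZMod r, x ^ 2 = 0 → x = 0 := fun x hx => pow_eq_zero_iff two_ne_zero |>.mp hx
  refine ⟨?_, ?_, ?_, ?_, ?_, ?_, ?_, ?_⟩ <;> intro x y h <;> push_cast at h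
  · -- `(2qy²)² = p(x²)²`
    obtain ⟨h1, h2⟩ := key (2 * (q : ZMod r) * y ^ 2) (x ^ 2) (by linear_combination -h)
    refine ⟨hx x h2, hx y ?_⟩
    rcases mul_eq_zero.mp h1 with h3 | h3
    · exact absurd h3 (mul_ne_zero h20' hq0')
    · exact h3
  · -- `q(px⁴ − 4y⁴) = 0`
    have h' : (q : ZMod r) * ((p : ZMod r) * x ^ 4 - 4 * y ^ 4) = 0 := by linear_combination h
    have h'' := (mul_eq_zero.mp h').resolve_left hq0'
    obtain ⟨h1, h2⟩ := key (2 * y ^ 2) (x ^ 2) (by linear_combination -h'')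
    exact ⟨hx x h2, hx y ((mul_eq_zero.mp h1).resolve_left h20')⟩
  · have h' : (2 : ZMod r) * ((p : ZMod r) * x ^ 4 - (q : ZMod r) ^ 2 * y ^ 4) = 0 := by linear_combination h
    have h'' := (mul_eq_zero.mp h').resolve_left h20'
    obtain ⟨h1, h2⟩ := key ((q : ZMod r) * y ^ 2) (x ^ 2) (by linear_combination -h'')
    exact ⟨hx x h2, hx y ((mul_eq_zero.mp h1).resolve_left hq0')⟩
  · have h' : (2 : ZMod r) * (q : ZMod r) * ((p : ZMod r) * x ^ 4 - y ^ 4) = 0 := by linear_combination h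
    have h'' := (mul_eq_zero.mp h').resolve_left (mul_ne_zero h20' hq0')
    obtain ⟨h1, h2⟩ := key (y ^ 2) (x ^ 2) (by linear_combination -h'')
    exact ⟨hx x h2, hx y h1⟩
  · obtain ⟨h1, h2⟩ := key (x ^ 2) (2 * (q : ZMod r) * y ^ 2) (by linear_combination -h)
    refine ⟨hx x h1, hx y ?_⟩
    rcases mul_eq_zero.mp h2 with h3 | h3
    · exact absurd h3 (mul_ne_zero h20' hq0')
    · exact h3
  · have h' : (q : ZMod r) * (-x ^ 4 + 4 * (p : ZMod r) * y ^ 4) = 0 := by linear_combination h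
    have h'' := (mul_eq_zero.mp h').resolve_left hq0'
    obtain ⟨h1, h2⟩ := key (x ^ 2) (2 * y ^ 2) (by linear_combination -h'')
    exact ⟨hx x h1, hx y ((mul_eq_zero.mp h2).resolve_left h20')⟩
  · have h' : (2 : ZMod r) * (-x ^ 4 + (p : ZMod r) * (q : ZMod r) ^ 2 * y ^ 4) = 0 := by linear_combination h
    have h'' := (mul_eq_zero.mp h').resolve_left h20'
    obtain ⟨h1, h2⟩ := key (x ^ 2) ((q : ZMod r) * y ^ 2) (by linear_combination -h'')
    exact ⟨hx x h1, hx y ((mul_eq_zero.mp h2).resolve_left hq0')⟩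
  · have h' : (2 : ZMod r) * (q : ZMod r) * (-x ^ 4 + (p : ZMod r) * y ^ 4) = 0 := by linear_combination h
    have h'' := (mul_eq_zero.mp h').resolve_left (mul_ne_zero h20' hq0')
    obtain ⟨h1, h2⟩ := key (x ^ 2) (y ^ 2) (by linear_combination -h'')
    exact ⟨hx x h1, hx y h2⟩

omit hp hq in
/-- **The eight kills at the partner**: classes `rp, rpq, 2rp, 2rpq, −r, −rq, −2r, −2rq` of `S(0, −4r²pq²)`. [cite: SilvermanAEC2009, proof of Prop. X.6.2(b)] -/
theorem partner_kills_plus (hnp : ¬ IsSquare ((p : ℤ) : ZMod r)) (hq0 : ((q : ℤ) : ZMod r) ≠ 0) (h20 : ((2 : ℤ) : ZMod r) ≠ 0) :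
    ¬ ((twoIsogenyQuartic 0 ((r : ℤ) * p) (-(4 * r * q ^ 2 : ℤ))).map (Int.castRingHom ℚ_[r])).IsSoluble ∧
    ¬ ((twoIsogenyQuartic 0 ((r : ℤ) * (p * q)) (-(4 * r * q : ℤ))).map (Int.castRingHom ℚ_[r])).IsSoluble ∧
    ¬ ((twoIsogenyQuartic 0 (2 * (r : ℤ) * p) (-(2 * r * q ^ 2 : ℤ))).map (Int.castRingHom ℚ_[r])).IsSoluble ∧
    ¬ ((twoIsogenyQuartic 0 (2 * (r : ℤ) * (p * q)) (-(2 * r * q : ℤ))).map (Int.castRingHom ℚ_[r])).IsSoluble ∧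
    ¬ ((twoIsogenyQuartic 0 (-(r : ℤ)) (4 * r * p * q ^ 2)).map (Int.castRingHom ℚ_[r])).IsSoluble ∧
    ¬ ((twoIsogenyQuartic 0 (-((r : ℤ) * q)) (4 * r * p * q)).map (Int.castRingHom ℚ_[r])).IsSoluble ∧
    ¬ ((twoIsogenyQuartic 0 (-(2 * (r : ℤ))) (2 * r * p * q ^ 2)).map (Int.castRingHom ℚ_[r])).IsSoluble ∧
    ¬ ((twoIsogenyQuartic 0 (-(2 * (r : ℤ) * q)) (2 * r * p * q)).map (Int.castRingHom ℚ_[r])).IsSoluble := by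
  obtain ⟨a1, a2, a3, a4, a5, a6, a7, a8⟩ := anisotropic_plus (p := p) (q := q) (r := r) hnp hq0 h20
  refine ⟨?_, ?_, ?_, ?_, ?_, ?_, ?_, ?_⟩
  · exact not_isSoluble_padic_of_dvd_of_dvd (ℓ := r) (c := (r : ℤ) * p) (c' := -(4 * r * q ^ 2 : ℤ)) (c₀ := (p : ℤ))
      (c₀' := -(4 * q ^ 2)) (by ring) (by ring) a1
  · exact not_isSoluble_padic_of_dvd_of_dvd (ℓ := r) (c := (r : ℤ) * (p * q)) (c' := -(4 * r * q : ℤ)) (c₀ := (p : ℤ) * q)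
      (c₀' := -(4 * q)) (by ring) (by ring) a2
  · exact not_isSoluble_padic_of_dvd_of_dvd (ℓ := r) (c := 2 * (r : ℤ) * p) (c' := -(2 * r * q ^ 2 : ℤ)) (c₀ := 2 * p)
      (c₀' := -(2 * q ^ 2)) (by ring) (by ring) a3
  · exact not_isSoluble_padic_of_dvd_of_dvd (ℓ := r) (c := 2 * (r : ℤ) * (p * q)) (c' := -(2 * r * q : ℤ)) (c₀ := 2 * ((p : ℤ) * q))
      (c₀' := -(2 * q)) (by ring) (by ring) a4
  · exact not_isSoluble_padic_of_dvd_of_dvd (ℓ := r) (c := -(r : ℤ)) (c' := 4 * r * p * q ^ 2) (c₀ := -1)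
      (c₀' := 4 * p * q ^ 2) (by ring) (by ring) a5
  · exact not_isSoluble_padic_of_dvd_of_dvd (ℓ := r) (c := -((r : ℤ) * q)) (c' := 4 * r * p * q) (c₀ := -(q : ℤ))
      (c₀' := 4 * p * q) (by ring) (by ring) a6
  · exact not_isSoluble_padic_of_dvd_of_dvd (ℓ := r) (c := -(2 * (r : ℤ))) (c' := 2 * r * p * q ^ 2) (c₀ := -2)
      (c₀' := 2 * p * q ^ 2) (by ring) (by ring) a7
  · exact not_isSoluble_padic_of_dvd_of_dvd (ℓ := r) (c := -(2 * (r : ℤ) * q)) (c' := 2 * r * p * q) (c₀ := -(2 * q))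
      (c₀' := 2 * p * q) (by ring) (by ring) a8

/-! ## §3 The two kills at `q` -/

omit hr in
/-- **Legendre symbols mod `q`** (`q ≡ 3 (mod 8)`, `p ≡ 3 (mod 4)`, `(q/p) = +1`, `q ∤ r`): `(2/q) = (−1/q) = (p/q) = −1`, `(r²/q) = +1`,
hence `2`, `−2p`, `−2r²p`, `2r²` are non-residues mod `q`. [folklore] -/
theorem nonresidues_mod_q_plus (hq8 : q % 8 = 3) (hp4 : p % 4 = 3) (hqp : q ≠ p) (hrq : r ≠ q) (hR : r.Prime)
    (hsq : IsSquare ((q : ℤ) : ZMod p)) :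
    ¬ IsSquare ((2 : ℤ) : ZMod q) ∧ ¬ IsSquare (((-(2 * p) : ℤ)) : ZMod q) ∧
    ¬ IsSquare (((-(2 * r ^ 2 * p) : ℤ)) : ZMod q) ∧ ¬ IsSquare (((2 * r ^ 2 : ℤ)) : ZMod q) := by
  have hQ := hq.out
  have hq2 : q ≠ 2 := by rintro rfl; omega
  have h2 : legendreSym q 2 = -1 := by
    rw [legendreSym.eq_neg_one_iff]
    have := Summit.BirchSwinnertonDyer.BirchSwinnertonDyer.Theorems.BiquadraticEisensteinDescentHeegnerTwistCouplingInSupplyQuarticTwistDescentDual.not_isSquare_two_mod_q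
      (q := q) hq8
    push_cast at this ⊢; exact this
  have hm1 : legendreSym q (-1) = -1 := by
    rw [legendreSym.at_neg_one hq2, ZMod.χ₄_nat_three_mod_four (by omega)]
  have hq0 : ((q : ℤ) : ZMod p) ≠ 0 := by
    intro h0
    have : (p : ℤ) ∣ q := (ZMod.intCast_zmod_eq_zero_iff_dvd q p).mp h0
    have : p ∣ q := by exact_mod_cast this
    exact hqp ((Nat.prime_dvd_prime_iff_eq hp.out hQ).mp this).symm
  have hpq : legendreSym q p = -1 := by
    rw [legendreSym.quadratic_reciprocity_three_mod_four hp4 (show q % 4 = 3 by omega), (legendreSym.eq_one_iff p hq0).mpr hsq]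
  have hr0 : ((r : ℤ) : ZMod q) ≠ 0 := by
    intro h0
    have : (q : ℤ) ∣ r := (ZMod.intCast_zmod_eq_zero_iff_dvd r q).mp h0
    have : q ∣ r := by exact_mod_cast this
    exact hrq ((Nat.prime_dvd_prime_iff_eq hQ hR).mp this).symm
  have hr2 : legendreSym q (r ^ 2) = 1 := by exact_mod_cast legendreSym.sq_one' q hr0
  refine ⟨(legendreSym.eq_neg_one_iff q).mp h2, ?_, ?_, ?_⟩ <;> rw [← legendreSym.eq_neg_one_iff q]
  · rw [show (-(2 * p) : ℤ) = (-1) * (2 * p) by ring, legendreSym.mul, legendreSym.mul, hm1, h2, hpq]; norm_num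
  · rw [show (-(2 * r ^ 2 * p) : ℤ) = (-1) * ((2 * r ^ 2) * p) by ring, legendreSym.mul, legendreSym.mul, legendreSym.mul,
      hm1, h2, hr2, hpq]; norm_num
  · rw [legendreSym.mul, h2, hr2]; norm_num

omit hr in
/-- **The two kills at `q`**: classes `2` and `−2p` of `S(0, −4r²pq²)` (`c` a non-residue, `c′ = q²·c″` with `c″` a non-residue mod `q`).
[cite: SilvermanAEC2009, proof of Prop. X.6.2(b)] -/
theorem q_kills_plus (hq8 : q % 8 = 3) (hp4 : p % 4 = 3) (hqp : q ≠ p) (hrq : r ≠ q) (hR : r.Prime)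
    (hsq : IsSquare ((q : ℤ) : ZMod p)) :
    ¬ ((twoIsogenyQuartic 0 (2 : ℤ) (-(2 * r ^ 2 * p * q ^ 2 : ℤ))).map (Int.castRingHom ℚ_[q])).IsSoluble ∧
    ¬ ((twoIsogenyQuartic 0 (-(2 * (p : ℤ))) (2 * r ^ 2 * q ^ 2)).map (Int.castRingHom ℚ_[q])).IsSoluble := by
  obtain ⟨n2, nm2p, nm2r2p, n2r2⟩ := nonresidues_mod_q_plus (p := p) (q := q) (r := r) hq8 hp4 hqp hrq hR hsq
  constructor
  · exact not_isSoluble_padic_of_sq_mul (ℓ := q) (c := 2) (c' := -(2 * r ^ 2 * p * q ^ 2 : ℤ)) (c'' := -(2 * r ^ 2 * p))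
      (by ring) n2 nm2r2p
  · exact not_isSoluble_padic_of_sq_mul (ℓ := q) (c := -(2 * (p : ℤ))) (c' := 2 * r ^ 2 * q ^ 2) (c'' := 2 * r ^ 2)
      (by ring) nm2p n2r2

end Summit.BirchSwinnertonDyer.BirchSwinnertonDyer.Theorems.BiquadraticEisensteinDescentHeegnerTwistCouplingInSupplyQuarticPlusDualKills

end
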